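import Summits.AnomalousDissipation.AnomalousDissipation.Theorems.SolenoidalFractalHomogenisationLagrangianStepCellClauseModWDefs
import Summits.AnomalousDissipation.AnomalousDissipation.Theorems.SolenoidalFractalHomogenisationLagrangianStepLossCurrencyRefChange
import Summits.AnomalousDissipation.AnomalousDissipation.Theorems.SolenoidalFractalHomogenisationLagrangianStepLabelSplit
import HarnessLib

/-!
# K1L_D (stmt-AnomalousDissipation-27980): (V_mod) FLAT STAGE «lossFlatW_of_V» — the 2×2 slow/fast BLOCK ARCHITECTURE with PROVED assembly
(line file of the (V_mod) lane, tenure T3 / memo K1loc-memo-v19 (ℓ2); prover ad-sawtooth-k1loc-p1 g14.  `sorry`-free: the five inputs are named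
`Prop`s (`CoarseSupp_text`, `Bss_text`, `Bsf_text`, `Bfs_text`, `Bff_text`) and the theorem `lossFlatW_of_blocks` assembles them into the
flat all-data loss-currency clause `CellClauseMod.SlowVectorClauseLossFlatW` at exponent `min σ ½`.)

TARGET.  `lossFlatW_of_V_text` : guards → (V)(σ, C) → `∃ Cm ≥ C, SlowVectorClauseLossFlatW W M hM c Φ lo hi Λ β (min σ ½) Cm ν₀ K`.
ARCHITECTURE.  Split every datum at the frequency ball `freqBall (n/4)` (`x = xₛ + x_f` with the label projector of `…LabelSplit.exists_labelProj`;
`xₛ` = all Bloch-class representatives of modulus `≤ n/4`, `x_f` = the rest).  The COARSE member `T` (no drift, constant tensor) is a Fourier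
multiplier, so its two losses are ADDITIVE over the split (`CoarseSupp_text`: `T s t` and its adjoint preserve Fourier supports ⇒
`q_T(x) = q_T(xₛ) + q_T(x_f)`, `q*_T(ζ) = q*_T(ζₛ) + q*_T(ζ_f)` by Parseval); the four blocks
* (ss) slow datum / slow test — (V) for `τ ≳ P` on the genuinely slow classes, crude decay on the others, generator level below `P`;
* (sf) slow datum / fast test — corrector emission (`z_ref + r`, w1's T4/T5), exponent `½`;
* (fs) fast datum / slow test — the sideband→slow LEAK (adjoint picture of (sf)), exponent `½`;
* (ff) fast / fast — band kill of `U` (`IsPropagator.bandKill`) + the enhanced kill of `T`, generator level below `1/r_{T,f}`;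
each in the common currency `ηᵢ = Cᵢ(Cᵢ(ν^σ′ + (⌈K/ν⌉/n)^σ′) + min(1, P/τ)^σ′)`, assemble with `LossCurrency.lossBound_add_blocks` to the clause with
`Cm = C₁ + C₂ + C₃ + C₄`.  Only (ss) consumes (V).  NOT a proof of any block, of `stub_Vmod_of_VR`, of K1L_D or AD; rung F-D1.A0.
-/

set_option linter.dupNamespace false

noncomputable section

namespace Summit.AnomalousDissipation.AnomalousDissipation.Theorems.SolenoidalFractalHomogenisation.LagrangianStep.VmodFlat

open Literature.Analysis Literature.Analysis.FluidPDE Literature.Analysis.FunctionSpaces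
open MeasureTheory Set Filter UnitAddTorus
open scoped ENNReal NNReal InnerProductSpace
open Summit.AnomalousDissipation.AnomalousDissipation.Theorems.SolenoidalFractalHomogenisation.LagrangianStep.CellClauseMod
open Summit.AnomalousDissipation.AnomalousDissipation.Theorems.SolenoidalFractalHomogenisation.LagrangianStep.LossCurrency

/-! ## §1 Fourier supports on `V2` -/

/-- Fourier coefficient of an `L²` class at the integer frequency `k`. -/
def fc (x : V2) (k : Fin 3 → ℤ) : EuclideanSpace ℂ (Fin 3) := mFourierCoeff (EuclideanSpace.complexify ∘ (⇑x : VF)) k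

/-- SLOW data at resolution `n`: no Fourier modes outside the ball `freqBall (n/4)`. -/
def IsSlow (n : ℕ) (x : V2) : Prop := ∀ k, k ∉ Torus.freqBall (d := Fin 3) (n / 4) → fc x k = 0

/-- FAST data at resolution `n`: no Fourier modes inside the ball `freqBall (n/4)`. -/
def IsFast (n : ℕ) (x : V2) : Prop := ∀ k ∈ Torus.freqBall (d := Fin 3) (n / 4), fc x k = 0

/-- `𝓕(x − y) = 𝓕x − 𝓕y` on `V2` (`fcoeff_sub`). -/
theorem fc_sub (x y : V2) (k : Fin 3 → ℤ) : fc (x - y) k = fc x k - fc y k := fcoeff_sub x y k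

/-- Fourier-disjoint `L²` classes are orthogonal (Parseval). [folklore] -/
theorem inner_eq_zero_of_fc_disjoint {x y : V2} (h : ∀ k, fc x k = 0 ∨ fc y k = 0) : ⟪x, y⟫_ℝ = 0 := by
  have hP := hasSum_inner_fcoeff x y
  have h0 : (fun k : Fin 3 → ℤ => (inner ℂ (mFourierCoeff (EuclideanSpace.complexify ∘ ⇑x) k)
      (mFourierCoeff (EuclideanSpace.complexify ∘ ⇑y) k)).re) = fun _ => 0 := by
    funext k
    rcases h k with hk | hk
    · show (inner ℂ (fc x k) (fc y k)).re = 0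
      rw [hk, inner_zero_left, Complex.zero_re]
    · show (inner ℂ (fc x k) (fc y k)).re = 0
      rw [hk, inner_zero_right, Complex.zero_re]
  rw [h0] at hP
  exact hP.unique hasSum_zero

/-! ## §2 The five inputs (typed targets) -/

/-- **(F0) Fourier-support preservation of drift-free constant-tensor propagators and of their adjoints** (the coarse member is a Fourier
multiplier).  Target of its own helper file (mode ODE `ae_inner_mFourierCoeff_eq` + uniqueness; adjoint via `Torus.adjoint_propagator`). -/
def CoarseSupp_text : Prop :=
  ∀ (Tw : ℝ) (𝔹 : Torus.Visc4 (Fin 3)) (lo' hi' : ℝ), 0 < lo' → Torus.NearIso 𝔹 lo' hi' →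
  ∀ T : ℝ → ℝ → (V2 →L[ℝ] V2), Torus.IsPropagator Tw (fun _ _ => 0) 𝔹 T →
  ∀ s t : ℝ, 0 ≤ s → s ≤ t → t ≤ Tw → ∀ (x : V2) (k : Fin 3 → ℤ), fc x k = 0 →
    fc (T s t x) k = 0 ∧ fc (ContinuousLinearMap.adjoint (T s t) x) k = 0

/-- **The common block shape**: the clause `SlowVectorClauseLossFlatW` with its data restricted by `Px n x`, `Pζ n ζ`. -/
def BlockBound {k : ℕ} (W : LatticeShear.LatticeWord k) (M : ℝ) (hM : 0 < M) (c : ℝ)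
    (Φ : ℝ → Torus.Visc4 (Fin 3) → Torus.Visc4 (Fin 3)) (lo hi Λ β σ Cb ν₀ K : ℝ) (Px Pζ : ℕ → V2 → Prop) : Prop :=
  ∀ ν, ∀ hν : ν ∈ Set.Ioo 0 ν₀, ∀ n : ℕ, (⌈K / ν⌉₊ : ℝ) ≤ n → ∀ 𝔸 : Torus.Visc4 (Fin 3),
    Torus.OddSmall 𝔸 (ν * β) → (∃ lam ∈ Set.Icc (1:ℝ) Λ, Torus.NearIso 𝔸 (ν * (lo / lam)) (ν * (hi * lam))) →
    Torus.OddSmall (Φ ν ((1 / ν) • 𝔸)) β → (∃ lam ∈ Set.Icc (1:ℝ) Λ, Torus.NearIso (Φ ν ((1 / ν) • 𝔸)) (lo / lam) (hi * lam)) →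
    ∀ Tw > (0:ℝ), ∀ U T : ℝ → ℝ → (V2 →L[ℝ] V2),
      Torus.IsPropagator Tw (cellField W M hM ν hν.1 n) ((1 / (n:ℝ) ^ 2) • 𝔸) U →
      Torus.IsPropagator Tw (fun _ _ => 0) ((1 / (n:ℝ) ^ 2) • (𝔸 + (c / ν) • Φ ν ((1 / ν) • 𝔸))) T →
    ∀ s t : ℝ, 0 ≤ s → s < t → t ≤ Tw → ∀ x ζ : V2, Px n x → Pζ n ζ →
      |⟪U s t x - T s t x, ζ⟫_ℝ|
        ≤ (Cb * (Cb * (ν ^ σ + ((⌈K / ν⌉₊ : ℝ) / n) ^ σ) + (min 1 ((M * W.period / ν) / (t - s))) ^ σ))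
          * Real.sqrt (lossFwd (T s t) x) * Real.sqrt (lossAdj (T s t) ζ)

/-- **(ss) slow datum / slow test** — the only block that consumes (V). -/
def Bss_text : Prop := ∀ k (W : LatticeShear.LatticeWord k) (M : ℝ) (hM : 0 < M) (c : ℝ), 0 < c →
  ∀ (Φ : ℝ → Torus.Visc4 (Fin 3) → Torus.Visc4 (Fin 3)) (lo hi Λ β σ C ν₀ K : ℝ),
    0 < lo → lo ≤ 1 → 1 ≤ hi → 1 < Λ → 0 ≤ β → 0 < σ → 0 ≤ C → 0 < ν₀ → ν₀ ≤ 1 → 0 < K →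
    SlowVectorClauseF W M hM c Φ lo hi Λ β σ C ν₀ K →
    ∃ C₁ : ℝ, C ≤ C₁ ∧ BlockBound W M hM c Φ lo hi Λ β (min σ (1 / 2)) C₁ ν₀ K IsSlow IsSlow

/-- **(sf) slow datum / fast test** (corrector emission). -/
def Bsf_text : Prop := ∀ k (W : LatticeShear.LatticeWord k) (M : ℝ) (hM : 0 < M) (c : ℝ), 0 < c →
  ∀ (Φ : ℝ → Torus.Visc4 (Fin 3) → Torus.Visc4 (Fin 3)) (lo hi Λ β σ ν₀ K : ℝ),
    0 < lo → lo ≤ 1 → 1 ≤ hi → 1 < Λ → 0 ≤ β → 0 < σ → 0 < ν₀ → ν₀ ≤ 1 → 0 < K →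
    ∃ C₂ : ℝ, 0 ≤ C₂ ∧ BlockBound W M hM c Φ lo hi Λ β (min σ (1 / 2)) C₂ ν₀ K IsSlow IsFast

/-- **(fs) fast datum / slow test** (the sideband→slow leak). -/
def Bfs_text : Prop := ∀ k (W : LatticeShear.LatticeWord k) (M : ℝ) (hM : 0 < M) (c : ℝ), 0 < c →
  ∀ (Φ : ℝ → Torus.Visc4 (Fin 3) → Torus.Visc4 (Fin 3)) (lo hi Λ β σ ν₀ K : ℝ),
    0 < lo → lo ≤ 1 → 1 ≤ hi → 1 < Λ → 0 ≤ β → 0 < σ → 0 < ν₀ → ν₀ ≤ 1 → 0 < K →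
    ∃ C₃ : ℝ, 0 ≤ C₃ ∧ BlockBound W M hM c Φ lo hi Λ β (min σ (1 / 2)) C₃ ν₀ K IsFast IsSlow

/-- **(ff) fast datum / fast test** (band kill of `U`, enhanced kill of `T`). -/
def Bff_text : Prop := ∀ k (W : LatticeShear.LatticeWord k) (M : ℝ) (hM : 0 < M) (c : ℝ), 0 < c →
  ∀ (Φ : ℝ → Torus.Visc4 (Fin 3) → Torus.Visc4 (Fin 3)) (lo hi Λ β σ ν₀ K : ℝ),
    0 < lo → lo ≤ 1 → 1 ≤ hi → 1 < Λ → 0 ≤ β → 0 < σ → 0 < ν₀ → ν₀ ≤ 1 → 0 < K →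
    ∃ C₄ : ℝ, 0 ≤ C₄ ∧ BlockBound W M hM c Φ lo hi Λ β (min σ (1 / 2)) C₄ ν₀ K IsFast IsFast

/-- The flat-stage target (memo v19 (ℓ2); = `VmodCut.lossFlatW_of_V_text`). -/
def lossFlatW_of_V_text : Prop := ∀ k (W : LatticeShear.LatticeWord k) (M : ℝ) (hM : 0 < M) (c : ℝ), 0 < c →
  ∀ (Φ : ℝ → Torus.Visc4 (Fin 3) → Torus.Visc4 (Fin 3)) (lo hi Λ β σ C ν₀ K : ℝ),
    0 < lo → lo ≤ 1 → 1 ≤ hi → 1 < Λ → 0 ≤ β → 0 < σ → 0 ≤ C → 0 < ν₀ → ν₀ ≤ 1 → 0 < K →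
    SlowVectorClauseF W M hM c Φ lo hi Λ β σ C ν₀ K →
    ∃ Cm : ℝ, C ≤ Cm ∧ SlowVectorClauseLossFlatW W M hM c Φ lo hi Λ β (min σ (1 / 2)) Cm ν₀ K

/-! ## §3 Algebra of the common currency -/

/-- Four block constants add: `Σᵢ Cᵢ(Cᵢ a + m) ≤ (Σᵢ Cᵢ)((Σᵢ Cᵢ) a + m)` for `Cᵢ, a ≥ 0`. [folklore] -/
theorem eta_sum_le {C₁ C₂ C₃ C₄ a m : ℝ} (h₁ : 0 ≤ C₁) (h₂ : 0 ≤ C₂) (h₃ : 0 ≤ C₃) (h₄ : 0 ≤ C₄) (ha : 0 ≤ a) :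
    C₁ * (C₁ * a + m) + C₂ * (C₂ * a + m) + C₃ * (C₃ * a + m) + C₄ * (C₄ * a + m)
      ≤ (C₁ + C₂ + C₃ + C₄) * ((C₁ + C₂ + C₃ + C₄) * a + m) := by
  nlinarith [mul_nonneg h₁ h₂, mul_nonneg h₁ h₃, mul_nonneg h₁ h₄, mul_nonneg h₂ h₃, mul_nonneg h₂ h₄, mul_nonneg h₃ h₄,
    mul_nonneg (mul_nonneg h₁ h₂) ha, mul_nonneg (mul_nonneg h₁ h₃) ha, mul_nonneg (mul_nonneg h₁ h₄) ha,
    mul_nonneg (mul_nonneg h₂ h₃) ha, mul_nonneg (mul_nonneg h₂ h₄) ha, mul_nonneg (mul_nonneg h₃ h₄) ha]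

/-! ## §4 The assembly -/

set_option maxHeartbeats 800000 in
/-- **ASSEMBLY: the four blocks and the coarse-multiplier fact give the flat all-data clause** with `Cm = C₁ + C₂ + C₃ + C₄`. -/
theorem lossFlatW_of_blocks (hF0 : CoarseSupp_text) (hss : Bss_text) (hsf : Bsf_text) (hfs : Bfs_text) (hff : Bff_text) :
    lossFlatW_of_V_text := by
  intro k W M hM c hc Φ lo hi Λ β σ C ν₀ K hlo hlo1 hhi hΛ hβ hσ hC hν₀ hν₀1 hK hV
  obtain ⟨C₁, hCC₁, B₁⟩ := hss k W M hM c hc Φ lo hi Λ β σ C ν₀ K hlo hlo1 hhi hΛ hβ hσ hC hν₀ hν₀1 hK hV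
  obtain ⟨C₂, hC₂, B₂⟩ := hsf k W M hM c hc Φ lo hi Λ β σ ν₀ K hlo hlo1 hhi hΛ hβ hσ hν₀ hν₀1 hK
  obtain ⟨C₃, hC₃, B₃⟩ := hfs k W M hM c hc Φ lo hi Λ β σ ν₀ K hlo hlo1 hhi hΛ hβ hσ hν₀ hν₀1 hK
  obtain ⟨C₄, hC₄, B₄⟩ := hff k W M hM c hc Φ lo hi Λ β σ ν₀ K hlo hlo1 hhi hΛ hβ hσ hν₀ hν₀1 hK
  have hC₁ : 0 ≤ C₁ := hC.trans hCC₁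
  refine ⟨C₁ + C₂ + C₃ + C₄, by linarith, ?_⟩
  intro ν hν n hn 𝔸 hodd hwin hΦo hΦw Tw hTw U T hU hT s t hs hst htT x ζ
  set σ' : ℝ := min σ (1 / 2) with hσ'
  -- the split at the frequency ball `freqBall (n/4)`
  set A : Set (Fin 3 → ℤ) := ↑(Torus.freqBall (d := Fin 3) (n / 4)) with hA
  have hAsym : ∀ k', k' ∈ A ↔ -k' ∈ A := fun k' => by
    rw [hA, Finset.mem_coe, Finset.mem_coe, Torus.neg_mem_freqBall]
  obtain ⟨P, hP⟩ := exists_labelProj A hAsym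
  have hPoff : ∀ (y : V2) (k' : Fin 3 → ℤ), k' ∉ Torus.freqBall (d := Fin 3) (n / 4) → fc (P y) k' = 0 := by
    intro y k' hk'
    have h := hP y k'
    rw [if_neg (by rwa [hA, Finset.mem_coe] : k' ∉ A)] at h
    exact h
  have hPon : ∀ (y : V2) (k' : Fin 3 → ℤ), k' ∈ Torus.freqBall (d := Fin 3) (n / 4) → fc (P y) k' = fc y k' := by
    intro y k' hk'
    have h := hP y k'
    rw [if_pos (by rwa [hA, Finset.mem_coe] : k' ∈ A)] at h
    exact h
  set xs : V2 := P x with hxs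
  set xf : V2 := x - P x with hxf
  set ζs : V2 := P ζ with hζs
  set ζf : V2 := ζ - P ζ with hζf
  have hx : x = xs + xf := by rw [hxs, hxf]; abel
  have hζ : ζ = ζs + ζf := by rw [hζs, hζf]; abel
  have slow_of : ∀ y : V2, IsSlow n (P y) := fun y k' hk' => hPoff y k' hk'
  have fast_of : ∀ y : V2, IsFast n (y - P y) := fun y k' hk' => by
    rw [fc_sub, hPon y k' hk', sub_self]
  have hxs_s : IsSlow n xs := slow_of x
  have hxf_f : IsFast n xf := fast_of x
  have hζs_s : IsSlow n ζs := slow_of ζ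
  have hζf_f : IsFast n ζf := fast_of ζ
  -- slow and fast pieces are Fourier-disjoint
  have disj : ∀ {y y' : V2}, IsSlow n y → IsFast n y' → ∀ k', fc y k' = 0 ∨ fc y' k' = 0 := by
    intro y y' hy hy' k'
    by_cases hk' : k' ∈ Torus.freqBall (d := Fin 3) (n / 4)
    · exact Or.inr (hy' k' hk')
    · exact Or.inl (hy k' hk')
  -- the coarse member: window of its tensor, support preservation (F0)
  have hn1 : (1:ℝ) ≤ n := by
    have h1 : (1:ℝ) ≤ ⌈K / ν⌉₊ := by
      have : 0 < K / ν := div_pos hK hν.1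
      exact_mod_cast Nat.one_le_iff_ne_zero.2 (Nat.pos_iff_ne_zero.1 (Nat.ceil_pos.2 this))
    exact h1.trans hn
  have hn0 : (0:ℝ) < n := by linarith
  obtain ⟨lam, hlam, hA𝔸⟩ := hwin
  obtain ⟨lam', hlam', hΦn⟩ := hΦw
  have hlam0 : 0 < lam := by linarith [hlam.1]
  have hlam'0 : 0 < lam' := by linarith [hlam'.1]
  have hcν : 0 ≤ c / ν := div_nonneg hc.le hν.1.le
  have hcoarse : Torus.NearIso ((1 / (n:ℝ) ^ 2) • (𝔸 + (c / ν) • Φ ν ((1 / ν) • 𝔸)))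
      ((1 / (n:ℝ) ^ 2) * (ν * (lo / lam) + (c / ν) * (lo / lam'))) ((1 / (n:ℝ) ^ 2) * (ν * (hi * lam) + (c / ν) * (hi * lam'))) :=
    (hA𝔸.add (hΦn.smul hcν)).smul (by positivity)
  have hlo' : 0 < (1 / (n:ℝ) ^ 2) * (ν * (lo / lam) + (c / ν) * (lo / lam')) := by
    have h1 : 0 < ν * (lo / lam) := mul_pos hν.1 (div_pos hlo hlam0)
    have h2 : 0 ≤ (c / ν) * (lo / lam') := mul_nonneg hcν (div_pos hlo hlam'0).le
    have h3 : 0 < 1 / (n:ℝ) ^ 2 := by positivity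
    exact mul_pos h3 (by linarith)
  have hsupp := hF0 Tw _ _ _ hlo' hcoarse T hT s t hs hst.le htT
  -- orthogonality of the split, before and after `T s t` / its adjoint
  have hTs_slow : IsSlow n (T s t xs) := fun k' hk' => (hsupp xs k' (hxs_s k' hk')).1
  have hTf_fast : IsFast n (T s t xf) := fun k' hk' => (hsupp xf k' (hxf_f k' hk')).1
  have hAs_slow : IsSlow n (ContinuousLinearMap.adjoint (T s t) ζs) := fun k' hk' => (hsupp ζs k' (hζs_s k' hk')).2
  have hAf_fast : IsFast n (ContinuousLinearMap.adjoint (T s t) ζf) := fun k' hk' => (hsupp ζf k' (hζf_f k' hk')).2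
  have hox : ⟪xs, xf⟫_ℝ = 0 := inner_eq_zero_of_fc_disjoint (disj hxs_s hxf_f)
  have hoTx : ⟪T s t xs, T s t xf⟫_ℝ = 0 := inner_eq_zero_of_fc_disjoint (disj hTs_slow hTf_fast)
  have hoζ : ⟪ζs, ζf⟫_ℝ = 0 := inner_eq_zero_of_fc_disjoint (disj hζs_s hζf_f)
  have hoAζ : ⟪ContinuousLinearMap.adjoint (T s t) ζs, ContinuousLinearMap.adjoint (T s t) ζf⟫_ℝ = 0 :=
    inner_eq_zero_of_fc_disjoint (disj hAs_slow hAf_fast)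
  -- additivity of the two losses over the split
  have hTc : ∀ y, ‖T s t y‖ ≤ ‖y‖ := hT.norm_le s t
  have hq_add : lossFwd (T s t) x = lossFwd (T s t) xs + lossFwd (T s t) xf := by
    unfold lossFwd; rw [hx]; exact loss_add_of_orthogonal hox hoTx
  have hqs_add : lossAdj (T s t) ζ = lossAdj (T s t) ζs + lossAdj (T s t) ζf := by
    unfold lossAdj; rw [hζ]; exact loss_add_of_orthogonal hoζ hoAζ
  have hq0 : ∀ y, 0 ≤ lossFwd (T s t) y := fun y => loss_nonneg hTc y
  have hqs0 : ∀ y, 0 ≤ lossAdj (T s t) y := fun y => lossAdj_nonneg hTc y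
  -- the four block bounds at the pieces
  have hwin' : ∃ lam ∈ Set.Icc (1:ℝ) Λ, Torus.NearIso 𝔸 (ν * (lo / lam)) (ν * (hi * lam)) := ⟨lam, hlam, hA𝔸⟩
  have hΦw' : ∃ lam ∈ Set.Icc (1:ℝ) Λ, Torus.NearIso (Φ ν ((1 / ν) • 𝔸)) (lo / lam) (hi * lam) := ⟨lam', hlam', hΦn⟩
  have b₁₁ := B₁ ν hν n hn 𝔸 hodd hwin' hΦo hΦw' Tw hTw U T hU hT s t hs hst htT xs ζs hxs_s hζs_s
  have b₁₂ := B₂ ν hν n hn 𝔸 hodd hwin' hΦo hΦw' Tw hTw U T hU hT s t hs hst htT xs ζf hxs_s hζf_f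
  have b₂₁ := B₃ ν hν n hn 𝔸 hodd hwin' hΦo hΦw' Tw hTw U T hU hT s t hs hst htT xf ζs hxf_f hζs_s
  have b₂₂ := B₄ ν hν n hn 𝔸 hodd hwin' hΦo hΦw' Tw hTw U T hU hT s t hs hst htT xf ζf hxf_f hζf_f
  -- common currency
  set a : ℝ := ν ^ σ' + ((⌈K / ν⌉₊ : ℝ) / n) ^ σ' with ha_def
  set m : ℝ := (min 1 ((M * W.period / ν) / (t - s))) ^ σ' with hm_def
  have ha0 : 0 ≤ a := by
    have h1 : 0 ≤ ν ^ σ' := Real.rpow_nonneg hν.1.le σ'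
    have h2 : 0 ≤ ((⌈K / ν⌉₊ : ℝ) / n) ^ σ' := Real.rpow_nonneg (by positivity) σ'
    rw [ha_def]; linarith
  have hP0 : 0 ≤ (M * W.period / ν) / (t - s) :=
    div_nonneg (div_nonneg (mul_nonneg hM.le
      (Summit.AnomalousDissipation.AnomalousDissipation.Theorems.SolenoidalFractalHomogenisation.PermissibleCarrier.period_pos W).le) hν.1.le)
      (by linarith)
  have hm0 : 0 ≤ m := by rw [hm_def]; exact Real.rpow_nonneg (le_min zero_le_one hP0) σ'
  have hη0 : ∀ {Cb : ℝ}, 0 ≤ Cb → 0 ≤ Cb * (Cb * a + m) := fun hCb => mul_nonneg hCb (by positivity)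
  -- bilinear expansion and the 2×2 bookkeeping
  have hlin : U s t x - T s t x = (U s t xs - T s t xs) + (U s t xf - T s t xf) := by
    rw [hx, map_add, map_add]; abel
  have key := lossBound_add_blocks (v₁ := U s t xs - T s t xs) (v₂ := U s t xf - T s t xf) (ζ₁ := ζs) (ζ₂ := ζf)
    (A := Real.sqrt (lossFwd (T s t) x)) (B := Real.sqrt (lossAdj (T s t) ζ))
    b₁₁ b₁₂ b₂₁ b₂₂ (hη0 hC₁) (hη0 hC₂) (hη0 hC₃) (hη0 hC₄)
    (Real.sqrt_nonneg _) (Real.sqrt_nonneg _) (Real.sqrt_nonneg _) (Real.sqrt_nonneg _)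
    (by rw [Real.sq_sqrt (hq0 xs), Real.sq_sqrt (hq0 xf), Real.sq_sqrt (hq0 x), hq_add])
    (by rw [Real.sq_sqrt (hqs0 ζs), Real.sq_sqrt (hqs0 ζf), Real.sq_sqrt (hqs0 ζ), hqs_add])
  rw [hlin, hζ]
  refine key.trans ?_
  have hsum := eta_sum_le (m := m) hC₁ hC₂ hC₃ hC₄ ha0
  have hAB : 0 ≤ Real.sqrt (lossFwd (T s t) x) * Real.sqrt (lossAdj (T s t) (ζs + ζf)) := by positivity
  rw [← hζ]
  calc (C₁ * (C₁ * a + m) + C₂ * (C₂ * a + m) + C₃ * (C₃ * a + m) + C₄ * (C₄ * a + m))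
        * Real.sqrt (lossFwd (T s t) x) * Real.sqrt (lossAdj (T s t) ζ)
      = (C₁ * (C₁ * a + m) + C₂ * (C₂ * a + m) + C₃ * (C₃ * a + m) + C₄ * (C₄ * a + m))
        * (Real.sqrt (lossFwd (T s t) x) * Real.sqrt (lossAdj (T s t) ζ)) := by ring
    _ ≤ ((C₁ + C₂ + C₃ + C₄) * ((C₁ + C₂ + C₃ + C₄) * a + m))
        * (Real.sqrt (lossFwd (T s t) x) * Real.sqrt (lossAdj (T s t) ζ)) :=
          mul_le_mul_of_nonneg_right hsum (by positivity)
    _ = ((C₁ + C₂ + C₃ + C₄) * ((C₁ + C₂ + C₃ + C₄) * a + m))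
        * Real.sqrt (lossFwd (T s t) x) * Real.sqrt (lossAdj (T s t) ζ) := by ring

end Summit.AnomalousDissipation.AnomalousDissipation.Theorems.SolenoidalFractalHomogenisation.LagrangianStep.VmodFlat

end
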